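import Summits.Langlands.Langlands.Theorems.SqrtFiveQuarticCoversCertificates
import Literature.NumberTheory.EllipticCurves.IsogenyHasCMBaseChangeAscentProofs

/-!
# Route `Langlands/SqrtFiveQuarticCovers` — certificate `CertE` = `CertB3H12E7` (carrier
# `X(b3,e7)`, genus 9, over `ℚ`; sheet 4.5 of the crux `RefinedLocusModular`) from the E10 census
# (cell `pub/lg-quartmod`, F-L1; CONDITIONAL bookkeeping — closes nothing by itself)

`certB3E7_of_modelIdentification_of_census` concludes VERBATIM the hypothesis `hE` of the tree's
assembly `refinedLocusModular_of_certificates` (`SqrtFiveQuarticCoversCertificates`, p653708): for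
every totally real quartic number field `K ∋ √5` and every `E / 𝓞 K` (`Δ ≠ 0`), if `ρ̄_{E,3}` is
Borel in some framing of `E[3]` and `ρ̄_{E,7}` has image in
`G(e7) = ⟨(0 5;3 0), (5 0;3 2)⟩ ⊂ C_ns⁺(7)` in some framing of `E[7]`, then `E` has CM or
`j(E) ∈ ℚ(√5)` (division-free: `∃ r, r² = 5, ∃ a b : ℚ, c₄³ = (a + b r)·Δ`).  (The level-`5`
hypothesis `H12` of sheet 4.5 is not needed: the cell closed the sheet on the level-`21` carrier.)

Notation (all from print, [cite: FreitasLeHungSiksek2015, Lemma 4.2 (p. 28)]): `X(e7) ≅ 49a4` is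
`y² = 7q(x)`, `q = 16x⁴+68x³+111x²+62x+11`, with `j = N(x)/D(x)`,
`N = (3x+1)³(4x²+5x+2)³(x²+3x+4)³(x²+10x+4)³`, `D = (x³+x²−2x−1)⁷`, `X(e7)(ℚ) = {(−1/3, ±14/9)}`;
`k = ℚ(√5)`, `σ` = the non-trivial automorphism of the quartic `K` over `k`;
`m(x) = −(5x+2)/(12x+5)` (negation of `49a4` with origin `O = (−1/3, 14/9)` read on `x`);
`Ψ₃(x₁,x₂) = (3x₂²+6x₂+2)²x₁⁴ + (36x₂⁴+125x₂³+138x₂²+60x₂+9)x₁³ + (48x₂⁴+138x₂³+111x₂²+33x₂+3)x₁²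
 + (24x₂⁴+60x₂³+33x₂²+5x₂)x₁ + (4x₂⁴+9x₂³+3x₂²)` (symmetric; the level-`3` modular correspondence for
the hauptmodul `x` of `X_ns⁺(7)`: `X(b3,e7) → {Ψ₃ = 0} ⊂ X(e7) × X(e7)`, `(x₁,x₂) = (x, x∘w₃)`).

The theorem rests on exactly FOUR written-out hypotheses (no `Prop` definitions under `Summits/`,
D-0027; names for the cell's ledger / a planner's second-layer split):

* `hK1` — **NF-K1-E10, MODEL IDENTIFICATION of `X(b3,e7)`** (named input, NOT proved in the tree):
  for `K` quartic with `√5 ∈ K`, an `E` as above has `j(E) = 1728` (`x = ∞` on `X(e7)`) or gives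
  `(x₁,y₁), (x₂,y₂) ∈ X(e7)(K)` — `E` and `E/C₃` with their `e7`-structures — with
  `j(E)·D(x₁) = N(x₁)`, `D(x₁) ≠ 0`, `Ψ₃(x₁,x₂) = 0`.  Sources: the model and `j`-map are print
  (FLS Lemma 4.2); `Ψ₃` is the cell's (eng-8 E10-REPORT (b1): the unique bidegree-(4,4) relation of
  `(x, x∘w₃)` from `P₀ = (−1/3, −27)`, `Ψ₃(a,x₂) | num Φ₃(j(a), j(x₂))` at four `a`; eng-3 E10-TWIN
  row 4(c): `Ψ₃` = the multiplicity-one bidegree-(4,4) factor of `Res_h` of the `X₀(3)`-relation and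
  its `w₃`-image — an independent algebraic derivation; certnum RQ-027 K4 ZDS l.142, check Z7:
  `Ψ ∣ num Φ₃(j(x₁), j(x₂))` by exact division); the case `x₂ = ∞` (`j(E/C₃) = 1728`) cannot occur
  over a quartic `K ∋ √5`: it needs a `K`-point at infinity of `y² = 7q(x)` (`√7 ∈ K`) with
  `(3x₁+3)² = 3` (`√3 ∈ K`) (E10-TWIN row 6, «chart at infinity»).
* `hE49` — **NF-E10-MW: `X(e7)(ℚ(√5)) = {(−1/3, ±14/9)}` and the group law read on `x`** (named
  input; FINITE DATUM + Kolyvagin): for `K` quartic, `r² = 5`, `σ ≠ id` fixing `r`, and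
  `(x,y) ∈ X(e7)(K)`: `σx = x` or `(12x+5)·σx = −(5x+2)` — because `Q + Q^σ ∈ X(e7)(k) = {O, T₀}`,
  `x(T₀ − Q) = x(Q)`, `x(−Q) = m(x(Q))`.  Rank `0` of `49a4` over `k`: `L(49a,1)·L(49a⊗χ₅,1) ≠ 0`
  EXACTLY (certnum RELEASES l.140, RQ-027 K1 LV0; eng-8 j313052, eng-3 exact modular symbols
  `T(1) = −1`, `T(χ₅) = −2`) + Kolyvagin–Logachev (named print fact) + torsion `ℤ/2` (l.140 K2
  TORE, `⟨(99/4, −99/8)⟩`); `X(e7)(ℚ)` is print (FLS Lemma 4.2); `m` = negation (eng-8 j313617;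
  eng-3 row 5: `q(m(x))·(12x+5)⁴ = q(x)` and the group-law test on all points over `𝔽₁₁`, `𝔽₁₃`;
  certnum K4 check Z1).
* `hZmm`, `hZmi` — **NF-E10-ZDS, the certified CENSUS** (FINITE DATUM, two independent exact
  lineages: eng-8 `E10-REPORT.md` sha16 27124f46183f2158 (b2)/(b3) / certnum-E10 packet
  8c57475d200e1699, Sage ideals; eng-3 `E10-TWIN.md` sha16 74120e68cc47c051 row 6, PARI; certnum
  RELEASES l.142 (2026-08-28T20:19:02Z), RQ-027 K4 ZDS 0.1 `zds-e10-all.json` 7467a9eb771d1498,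
  PASS on an independent lineage R + checker replay — RQ-027 ALL FOUR KINDS (K1 LV0, K2 TORE,
  K3 CBC, K4 ZDS) CERTIFIED l.140–l.142, CLOSED; cell words SHEET-WORDS-v0.md v0.2 sha16
  828c8ad09b15e9a5): the closed points of degree `≤ 2` over `k` of `Y_x ∩ τ(Y_x)`, `Y_x = {Ψ₃ = 0}`: for
  `τ = m×m` EXACTLY `(−1/3,−1/3)` and the orbit `x₁ ~ x²+10x+4` (`x₂ = x̄₁`, residue field `ℚ(√21)`,
  `7q(x₁) = (−84x₁−35)²`) — the `√2`-orbit `x₁ = 1 ± √2` of `Y_x ∩ (m×m)Y_x` does not lift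
  (`7q(1±√2) = 8078 ± 5712√2` is not a square in `ℚ(√2,√5)`), the residue fields of degree `4` do
  not contain `√5`; for `τ = m×id` only `(−1/3,−1/3)`.  Stated in coordinates for a quartic `K ∋ √5`
  and `K`-solutions `(x₁, y₁, x₂, x₁' = m(x₁), x₂' = m(x₂))`.  «A certified finite datum is not a
  modularity statement.»

Everything else is PROVED here, kernel-checked: the construction of `σ` (the quartic `K ∋ r` is a
quadratic, hence Galois, extension of `ℚ(r)`; `minpoly_ℚ r = X² − 5`), the fixed field
`K^σ = ℚ(r) = {a + b r}` (Galois correspondence + power basis), `σ`-equivariance of `Ψ₃` and of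
`j = N/D`, the vanishing `N(−1/3) = 0 = N(x)` for `x² + 10x + 4 = 0` (so those points are `j = 0`,
CM by `WeierstrassCurve.HasCM.of_j_eq_zero`), `j = 1728 ⇒` CM, and the case analysis of E10
(LOGIC CHECK of E10-TWIN): `σx₁ = x₁ ⇒ j(E) ∈ ℚ(√5)`; else `σx₁ = m(x₁)` and then `σx₂ = x₂`
(census `m×id`: `x₁ = −1/3`) or `σx₂ = m(x₂)` (census `m×m`: `x₁ = −1/3` or `x₁² + 10x₁ + 4 = 0`),
`j(E) = 0` in all three.

HONEST STATUS: conditional bookkeeping over one explicit quartic family; the hypotheses are a model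
identification, a rank-`0` datum resting on Kolyvagin–Logachev, and a certified finite census —
none proved in Lean; nothing here proves modularity of a new class of elliptic curves.  Cell
record: CENSUS.md §15 row 4.5; STATUS 2026-08-28T20:31:43Z (SHEET × LINEAGE TABLE, 4.5) and
20:32:07Z (SHEET STATEMENT WORDS v0, CertE).
`certB3E7` restates the main theorem with conclusion the route decl
`Summit.Langlands.Langlands.Theses.SqrtFiveQuarticCovers.CertB3E7` BY NAME (item stmt-Langlands-23416
of rev 7 of the route, the by-carrier split of `RefinedLocusModular`).
References: [FreitasLeHungSiksek2015] Lemma 4.2, p. 28 (arXiv:1310.7088); [Box2022] §1.1, Thm. 7.1;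
[SilvermanAEC2009] III.10.1, App. C §11.
-/

set_option linter.dupNamespace false -- project-wide option (lakefile weak.linter.dupNamespace); `Summit.Langlands.Langlands` is the mandated namespace

namespace Summit.Langlands.Langlands.Theorems.SqrtFiveQuarticCovers

open scoped Matrix IntermediateField
open Polynomial Literature.NumberTheory.Automorphic

/-! ## 1. Kernel-checked field theory: the quadratic subfield `ℚ(r)` and the automorphism `σ` -/

/-- Elements of `ℚ(r)`, `r² = 5`, are `a + b·r` with `a b : ℚ` (power basis `1, r` of
`ℚ(r) = ℚ[X]/(X² − 5)`).  (Same content as `exists_rat_add_rat_mul_of_mem_adjoin` of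
`Theorems/SqrtFiveQuarticCoversCertS3H12.lean`; own copy under a distinct name so that the two
certificate files stay import-independent.) [folklore] -/
theorem exists_rat_add_rat_mul_of_mem_adjoin_sqrt_five {K : Type} [Field K] [NumberField K] {r : K}
    (hr : r ^ 2 = 5) {z : K} (hz : z ∈ ℚ⟮r⟯) : ∃ a b : ℚ, z = (a : K) + (b : K) * r := by
  have hr_int : IsIntegral ℚ r := Algebra.IsIntegral.isIntegral r
  set pb := IntermediateField.adjoin.powerBasis hr_int with hpb
  have hdim : pb.dim = 2 := by
    rw [hpb, IntermediateField.adjoin.powerBasis_dim, minpoly_eq_X_sq_sub_five hr,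
      natDegree_X_pow_sub_C]
  obtain ⟨f, hf, hzf⟩ := pb.exists_eq_aeval ⟨z, hz⟩
  rw [hdim] at hf
  have hf1 : f.natDegree ≤ 1 := by omega
  have hgen : ((pb.gen : ℚ⟮r⟯) : K) = r := by
    rw [hpb, IntermediateField.adjoin.powerBasis_gen, IntermediateField.AdjoinSimple.coe_gen]
  have hc : ∀ c : ℚ, ((algebraMap ℚ ℚ⟮r⟯ c : ℚ⟮r⟯) : K) = (c : K) := fun c => by
    rw [← eq_ratCast (algebraMap ℚ K) c]
    rfl
  have hz' : z = ((aeval pb.gen f : ℚ⟮r⟯) : K) := congrArg (fun w : ℚ⟮r⟯ => (w : K)) hzf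
  rw [Polynomial.eq_X_add_C_of_natDegree_le_one hf1] at hz'
  simp only [map_add, map_mul, aeval_C, aeval_X] at hz'
  refine ⟨f.coeff 0, f.coeff 1, ?_⟩
  rw [hz', AddMemClass.coe_add, MulMemClass.coe_mul, hc, hc, hgen]
  ring

/-- **The quadratic automorphism.**  For `K` a quartic number field and `r ∈ K` with `r² = 5` there
is a ring automorphism `σ ≠ id` of `K` fixing `r`, and every element fixed by `σ` lies in
`ℚ(r)`, i.e. is `a + b·r` with `a b : ℚ` (`K/ℚ(r)` is quadratic, hence Galois with group `{1, σ}`;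
Galois correspondence). [folklore] -/
theorem exists_ringHom_ne_id_fixing_sqrt_five {K : Type} [Field K] [NumberField K]
    (hd : Module.finrank ℚ K = 4) {r : K} (hr : r ^ 2 = 5) :
    ∃ σ : K →+* K, σ r = r ∧ σ ≠ RingHom.id K ∧
      ∀ z : K, σ z = z → ∃ a b : ℚ, z = (a : K) + (b : K) * r := by
  have hr_int : IsIntegral ℚ r := Algebra.IsIntegral.isIntegral r
  have hF2 : Module.finrank ℚ ℚ⟮r⟯ = 2 := by
    rw [IntermediateField.adjoin.finrank hr_int, minpoly_eq_X_sq_sub_five hr, natDegree_X_pow_sub_C]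
  have hFK : Module.finrank ℚ⟮r⟯ K = 2 := by
    have h := Module.finrank_mul_finrank ℚ ℚ⟮r⟯ K
    rw [hF2, hd] at h
    omega
  haveI : Algebra.IsQuadraticExtension ℚ⟮r⟯ K := ⟨hFK⟩
  haveI : IsGalois ℚ⟮r⟯ K := inferInstance
  have hcard : Nat.card (K ≃ₐ[ℚ⟮r⟯] K) = 2 := by
    rw [IsGalois.card_aut_eq_finrank, hFK]
  -- the Galois group is `{1, σ₀}`
  obtain ⟨σ₀, hσ₀, huniq⟩ := (Nat.card_eq_two_iff' (1 : K ≃ₐ[ℚ⟮r⟯] K)).1 hcard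
  have hall : ∀ g : K ≃ₐ[ℚ⟮r⟯] K, g = 1 ∨ g = σ₀ := fun g => by
    by_cases hg : g = 1
    · exact Or.inl hg
    · exact Or.inr (huniq g hg)
  refine ⟨(σ₀ : K →+* K), ?_, ?_, ?_⟩
  · -- `σ₀` fixes `r ∈ ℚ(r)`
    have h := σ₀.commutes ⟨r, IntermediateField.mem_adjoin_simple_self ℚ r⟩
    exact h
  · intro h
    apply hσ₀
    ext z
    exact congrArg (fun f : K →+* K => f z) h
  · intro z hz
    have hfix : ∀ f : K ≃ₐ[ℚ⟮r⟯] K, f z = z := by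
      intro f
      rcases hall f with rfl | rfl
      · rfl
      · exact hz
    have hmem : z ∈ (⊥ : IntermediateField ℚ⟮r⟯ K) := (IsGalois.mem_bot_iff_fixed z).2 hfix
    rw [IntermediateField.mem_bot] at hmem
    obtain ⟨z', hz'⟩ := hmem
    obtain ⟨a, b, hab⟩ := exists_rat_add_rat_mul_of_mem_adjoin_sqrt_five hr z'.2
    refine ⟨a, b, ?_⟩
    rw [← hz', ← hab]
    rfl

/-! ## 2. Kernel-checked arithmetic on `X(e7)`: the `j = 0` fibres met by the census -/

/-- `N(−1/3) = 0`: the rational points `(−1/3, ±14/9)` of `X(e7)` lie over `j = 0`. [folklore] -/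
theorem fls_N_eq_zero_of_three_mul_add_one {K : Type} [Field K] {x : K} (h : 3 * x + 1 = 0) :
    (3 * x + 1) ^ 3 * (4 * x ^ 2 + 5 * x + 2) ^ 3 * (x ^ 2 + 3 * x + 4) ^ 3 * (x ^ 2 + 10 * x + 4) ^ 3
      = 0 := by
  rw [h]
  ring

/-- `N(x) = 0` on the orbit `x² + 10x + 4 = 0` (the CM points of `X(b3,e7)` over `ℚ(√21)`, `j = 0`).
[folklore] -/
theorem fls_N_eq_zero_of_sq_add {K : Type} [Field K] {x : K} (h : x ^ 2 + 10 * x + 4 = 0) :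
    (3 * x + 1) ^ 3 * (4 * x ^ 2 + 5 * x + 2) ^ 3 * (x ^ 2 + 3 * x + 4) ^ 3 * (x ^ 2 + 10 * x + 4) ^ 3
      = 0 := by
  rw [h]
  ring

/-- `c₄(E_K)³ = q·Δ(E_K)` with `q ∈ cmJInvariants` ⇒ CM (as in the `CertH12B7` file; private copy
to keep the two certificate files independent). [cite: SilvermanAEC2009, App. C §11, Example 11.3.1–11.3.2] -/
private theorem hasCM_of_c₄_cube_eq_mul_Δ' {K : Type} [Field K] [NumberField K]
    (E : WeierstrassCurve (NumberField.RingOfIntegers K)) (hΔ : E.Δ ≠ 0) {q : ℚ}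
    (hq : q ∈ WeierstrassCurve.cmJInvariants)
    (h : (E.baseChange K).c₄ ^ 3 = (q : K) * (E.baseChange K).Δ) : (E.baseChange K).HasCM := by
  haveI hW : (E.baseChange K).IsElliptic := isElliptic_baseChange_of_Δ_ne_zero hΔ
  have hΔK : (E.baseChange K).Δ ≠ 0 := hW.isUnit.ne_zero
  refine WeierstrassCurve.hasCM_of_j_eq_of_mem_cmJInvariants (E.baseChange K) hq ?_
  rw [WeierstrassCurve.j_eq_c₄_pow_three_div_Δ, h, mul_div_assoc, div_self hΔK, mul_one]

/-! ## 3. The certificate `CertE` (`CertB3H12E7`) from the model identification and the census -/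

/-- **`CertE` = `CertB3H12E7` — hypothesis `hE` of `refinedLocusModular_of_certificates`,
VERBATIM — from NF-K1-E10 (model identification, `hK1`), NF-E10-MW (`X(e7)(ℚ(√5))` + group law,
`hE49`) and the certified census NF-E10-ZDS (`hZmm`, `hZmi`; lineages E10-REPORT.md
27124f46183f2158 + E10-TWIN.md 74120e68cc47c051; certnum RELEASES l.140–l.142, RQ-027 CLOSED).**
For `K` totally real quartic with `√5 ∈ K` and `E / 𝓞 K` (`Δ ≠ 0`) with a Borel mod-`3` image and
mod-`7` image in `G(e7)` (some framings): `E` has CM or `j(E) ∈ ℚ(√5)`.  Proof = E10's deduction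
(E10-REPORT (b2), E10-TWIN LOGIC CHECK), kernel-checked: see the module docstring.
CONDITIONAL on the four hypotheses. [cite: FreitasLeHungSiksek2015, Lemma 4.2 (p. 28)]
[cite: Box2022, §1.1 and Thm. 7.1] [cite: SilvermanAEC2009, Thm. III.10.1] -/
theorem certB3E7_of_modelIdentification_of_census
    (hK1 : ∀ (K : Type) [Field K] [NumberField K], Module.finrank ℚ K = 4 → (∃ r : K, r ^ 2 = 5) →
        ∀ E : WeierstrassCurve (NumberField.RingOfIntegers K), E.Δ ≠ 0 →
          (∃ ρ : Literature.NumberTheory.GaloisRepresentations.FramedGaloisRep K (ZMod 3) 2, (∃ e : (E.baseChange K).geomTorsion ((3 : ℕ) : ℤ) ≃+ (Fin 2 → ZMod 3), ∀ (σ : Field.absoluteGaloisGroup K) (P : (E.baseChange K).geomTorsion ((3 : ℕ) : ℤ)), e (σ • P) = ((ρ σ : GL (Fin 2) (ZMod 3)) : Matrix (Fin 2) (Fin 2) (ZMod 3)) *ᵥ (e P)) ∧ ((∀ σ : Field.absoluteGaloisGroup K, (((ρ σ : GL (Fin 2) (ZMod 3)) : Matrix (Fin 2) (Fin 2) (ZMod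 3)) 1 0 = 0)))) →
          (∃ ρ : Literature.NumberTheory.GaloisRepresentations.FramedGaloisRep K (ZMod 7) 2, (∃ e : (E.baseChange K).geomTorsion ((7 : ℕ) : ℤ) ≃+ (Fin 2 → ZMod 7), ∀ (σ : Field.absoluteGaloisGroup K) (P : (E.baseChange K).geomTorsion ((7 : ℕ) : ℤ)), e (σ • P) = ((ρ σ : GL (Fin 2) (ZMod 7)) : Matrix (Fin 2) (Fin 2) (ZMod 7)) *ᵥ (e P)) ∧ ((∀ σ : Field.absoluteGaloisGroup K, (ρ σ : GL (Fin 2) (ZMod 7)) ∈ Subgroup.closure ({(⟨!![0, 5; 3, 0], !![0, 5; 3, 0], by decide, by decide⟩ : GL (Fin 2) (ZMod 7)), (⟨!![5, 0; 3, 2], !![3, 0; 6, 4], by decide, by decide⟩ : GL (Fin 2) (ZMod 7))} : Set (GL (Fin 2) (ZMod 7)))))) →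
          ((E.baseChange K).c₄ ^ 3 = 1728 * (E.baseChange K).Δ ∨
           ∃ x₁ y₁ x₂ y₂ : K, y₁ ^ 2 = 7 * (16 * x₁ ^ 4 + 68 * x₁ ^ 3 + 111 * x₁ ^ 2 + 62 * x₁ + 11) ∧ y₂ ^ 2 = 7 * (16 * x₂ ^ 4 + 68 * x₂ ^ 3 + 111 * x₂ ^ 2 + 62 * x₂ + 11) ∧
            ((x₁ ^ 3 + x₁ ^ 2 - 2 * x₁ - 1) ^ 7) ≠ 0 ∧
            (E.baseChange K).c₄ ^ 3 * ((x₁ ^ 3 + x₁ ^ 2 - 2 * x₁ - 1) ^ 7) = ((3 * x₁ + 1) ^ 3 * (4 * x₁ ^ 2 + 5 * x₁ + 2) ^ 3 * (x₁ ^ 2 + 3 * x₁ + 4) ^ 3 * (x₁ ^ 2 + 10 * x₁ + 4) ^ 3) * (E.baseChange K).Δ ∧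
            ((3 * x₂ ^ 2 + 6 * x₂ + 2) ^ 2 * x₁ ^ 4 + (36 * x₂ ^ 4 + 125 * x₂ ^ 3 + 138 * x₂ ^ 2 + 60 * x₂ + 9) * x₁ ^ 3 + (48 * x₂ ^ 4 + 138 * x₂ ^ 3 + 111 * x₂ ^ 2 + 33 * x₂ + 3) * x₁ ^ 2 + (24 * x₂ ^ 4 + 60 * x₂ ^ 3 + 33 * x₂ ^ 2 + 5 * x₂) * x₁ + (4 * x₂ ^ 4 + 9 * x₂ ^ 3 + 3 * x₂ ^ 2)) = 0))
    (hE49 : ∀ (K : Type) [Field K] [NumberField K], Module.finrank ℚ K = 4 → ∀ r : K, r ^ 2 = 5 →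
        ∀ σ : K →+* K, σ r = r → σ ≠ RingHom.id K →
          ∀ x y : K, y ^ 2 = 7 * (16 * x ^ 4 + 68 * x ^ 3 + 111 * x ^ 2 + 62 * x + 11) → (σ x = x ∨ (12 * x + 5) * σ x = -(5 * x + 2)))
    (hZmm : ∀ (K : Type) [Field K] [NumberField K], Module.finrank ℚ K = 4 → (∃ r : K, r ^ 2 = 5) →
        ∀ x₁ y₁ x₂ x₁' x₂' : K, y₁ ^ 2 = 7 * (16 * x₁ ^ 4 + 68 * x₁ ^ 3 + 111 * x₁ ^ 2 + 62 * x₁ + 11) →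
          ((3 * x₂ ^ 2 + 6 * x₂ + 2) ^ 2 * x₁ ^ 4 + (36 * x₂ ^ 4 + 125 * x₂ ^ 3 + 138 * x₂ ^ 2 + 60 * x₂ + 9) * x₁ ^ 3 + (48 * x₂ ^ 4 + 138 * x₂ ^ 3 + 111 * x₂ ^ 2 + 33 * x₂ + 3) * x₁ ^ 2 + (24 * x₂ ^ 4 + 60 * x₂ ^ 3 + 33 * x₂ ^ 2 + 5 * x₂) * x₁ + (4 * x₂ ^ 4 + 9 * x₂ ^ 3 + 3 * x₂ ^ 2)) = 0 →
          (12 * x₁ + 5) * x₁' = -(5 * x₁ + 2) → (12 * x₂ + 5) * x₂' = -(5 * x₂ + 2) →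
          ((3 * x₂' ^ 2 + 6 * x₂' + 2) ^ 2 * x₁' ^ 4 + (36 * x₂' ^ 4 + 125 * x₂' ^ 3 + 138 * x₂' ^ 2 + 60 * x₂' + 9) * x₁' ^ 3 + (48 * x₂' ^ 4 + 138 * x₂' ^ 3 + 111 * x₂' ^ 2 + 33 * x₂' + 3) * x₁' ^ 2 + (24 * x₂' ^ 4 + 60 * x₂' ^ 3 + 33 * x₂' ^ 2 + 5 * x₂') * x₁' + (4 * x₂' ^ 4 + 9 * x₂' ^ 3 + 3 * x₂' ^ 2)) = 0 →
          (3 * x₁ + 1 = 0 ∨ x₁ ^ 2 + 10 * x₁ + 4 = 0))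
    (hZmi : ∀ (K : Type) [Field K] [NumberField K], Module.finrank ℚ K = 4 → (∃ r : K, r ^ 2 = 5) →
        ∀ x₁ y₁ x₂ x₁' : K, y₁ ^ 2 = 7 * (16 * x₁ ^ 4 + 68 * x₁ ^ 3 + 111 * x₁ ^ 2 + 62 * x₁ + 11) →
          ((3 * x₂ ^ 2 + 6 * x₂ + 2) ^ 2 * x₁ ^ 4 + (36 * x₂ ^ 4 + 125 * x₂ ^ 3 + 138 * x₂ ^ 2 + 60 * x₂ + 9) * x₁ ^ 3 + (48 * x₂ ^ 4 + 138 * x₂ ^ 3 + 111 * x₂ ^ 2 + 33 * x₂ + 3) * x₁ ^ 2 + (24 * x₂ ^ 4 + 60 * x₂ ^ 3 + 33 * x₂ ^ 2 + 5 * x₂) * x₁ + (4 * x₂ ^ 4 + 9 * x₂ ^ 3 + 3 * x₂ ^ 2)) = 0 →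
          (12 * x₁ + 5) * x₁' = -(5 * x₁ + 2) →
          ((3 * x₂ ^ 2 + 6 * x₂ + 2) ^ 2 * x₁' ^ 4 + (36 * x₂ ^ 4 + 125 * x₂ ^ 3 + 138 * x₂ ^ 2 + 60 * x₂ + 9) * x₁' ^ 3 + (48 * x₂ ^ 4 + 138 * x₂ ^ 3 + 111 * x₂ ^ 2 + 33 * x₂ + 3) * x₁' ^ 2 + (24 * x₂ ^ 4 + 60 * x₂ ^ 3 + 33 * x₂ ^ 2 + 5 * x₂) * x₁' + (4 * x₂ ^ 4 + 9 * x₂ ^ 3 + 3 * x₂ ^ 2)) = 0 →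
          3 * x₁ + 1 = 0) :
    ∀ (K : Type) [Field K] [NumberField K], NumberField.IsTotallyReal K → Module.finrank ℚ K = 4 → (∃ r : K, r ^ 2 = 5) →
        ∀ E : WeierstrassCurve (NumberField.RingOfIntegers K), E.Δ ≠ 0 →
          (∃ ρ : Literature.NumberTheory.GaloisRepresentations.FramedGaloisRep K (ZMod 3) 2, (∃ e : (E.baseChange K).geomTorsion ((3 : ℕ) : ℤ) ≃+ (Fin 2 → ZMod 3), ∀ (σ : Field.absoluteGaloisGroup K) (P : (E.baseChange K).geomTorsion ((3 : ℕ) : ℤ)), e (σ • P) = ((ρ σ : GL (Fin 2) (ZMod 3)) : Matrix (Fin 2) (Fin 2) (ZMod 3)) *ᵥ (e P)) ∧ ((∀ σ : Field.absoluteGaloisGroup K, (((ρ σ : GL (Fin 2) (ZMod 3)) : Matrix (Fin 2) (Fin 2) (ZMod 3)) 1 0 = 0)))) →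
          (∃ ρ : Literature.NumberTheory.GaloisRepresentations.FramedGaloisRep K (ZMod 7) 2, (∃ e : (E.baseChange K).geomTorsion ((7 : ℕ) : ℤ) ≃+ (Fin 2 → ZMod 7), ∀ (σ : Field.absoluteGaloisGroup K) (P : (E.baseChange K).geomTorsion ((7 : ℕ) : ℤ)), e (σ • P) = ((ρ σ : GL (Fin 2) (ZMod 7)) : Matrix (Fin 2) (Fin 2) (ZMod 7)) *ᵥ (e P)) ∧ ((∀ σ : Field.absoluteGaloisGroup K, (ρ σ : GL (Fin 2) (ZMod 7)) ∈ Subgroup.closure ({(⟨!![0, 5; 3, 0], !![0, 5; 3, 0], by decide, by decide⟩ : GL (Fin 2) (ZMod 7)), (⟨!![5, 0; 3, 2], !![3, 0; 6, 4], by decide, by decide⟩ : GL (Fin 2) (ZMod 7))} : Set (GL (Fin 2) (ZMod 7)))))) →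
          ((E.baseChange K).HasCM ∨ (∃ r : K, r ^ 2 = 5 ∧ ∃ a b : ℚ, (E.baseChange K).c₄ ^ 3 = ((a : K) + (b : K) * r) * (E.baseChange K).Δ)) := by
  intro K _ _ _ hd hr5 E hΔ h3 h7
  haveI hW : (E.baseChange K).IsElliptic := isElliptic_baseChange_of_Δ_ne_zero hΔ
  have hΔK : (E.baseChange K).Δ ≠ 0 := hW.isUnit.ne_zero
  obtain ⟨r, hr⟩ := hr5
  obtain ⟨σ, hσr, hσ, hfix⟩ := exists_ringHom_ne_id_fixing_sqrt_five hd hr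
  rcases hK1 K hd ⟨r, hr⟩ E hΔ h3 h7 with h1728 | ⟨x₁, y₁, x₂, y₂, hy₁, hy₂, hD, hj, hΨ⟩
  · exact Or.inl (hasCM_of_c₄_cube_eq_mul_Δ' E hΔ (q := 1728) (by decide)
      (by rw [h1728]; push_cast; ring))
  -- `σ` applied to the correspondence
  have hΨσ : ((3 * (σ x₂) ^ 2 + 6 * (σ x₂) + 2) ^ 2 * (σ x₁) ^ 4 + (36 * (σ x₂) ^ 4 + 125 * (σ x₂) ^ 3 + 138 * (σ x₂) ^ 2 + 60 * (σ x₂) + 9) * (σ x₁) ^ 3 + (48 * (σ x₂) ^ 4 + 138 * (σ x₂) ^ 3 + 111 * (σ x₂) ^ 2 + 33 * (σ x₂) + 3) * (σ x₁) ^ 2 + (24 * (σ x₂) ^ 4 + 60 * (σ x₂) ^ 3 + 33 * (σ x₂) ^ 2 + 5 * (σ x₂)) * (σ x₁) + (4 * (σ x₂) ^ 4 + 9 * (σ x₂) ^ 3 + 3 * (σ x₂) ^ 2)) = 0 := by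
    have h := congrArg σ hΨ
    simp only [map_add, map_mul, map_pow, map_ofNat, map_zero] at h
    exact h
  rcases hE49 K hd r hr σ hσr hσ x₁ y₁ hy₁ with hx₁ | hx₁
  · -- `x₁ ∈ k`: `j(E) = N(x₁)/D(x₁) ∈ ℚ(√5)`
    right
    refine ⟨r, hr, ?_⟩
    have hjfix : σ (((3 * x₁ + 1) ^ 3 * (4 * x₁ ^ 2 + 5 * x₁ + 2) ^ 3 * (x₁ ^ 2 + 3 * x₁ + 4) ^ 3 * (x₁ ^ 2 + 10 * x₁ + 4) ^ 3) / ((x₁ ^ 3 + x₁ ^ 2 - 2 * x₁ - 1) ^ 7)) = ((3 * x₁ + 1) ^ 3 * (4 * x₁ ^ 2 + 5 * x₁ + 2) ^ 3 * (x₁ ^ 2 + 3 * x₁ + 4) ^ 3 * (x₁ ^ 2 + 10 * x₁ + 4) ^ 3) / ((x₁ ^ 3 + x₁ ^ 2 - 2 * x₁ - 1) ^ 7) := by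
      simp only [map_div₀, map_add, map_mul, map_pow, map_sub, map_ofNat, map_one, hx₁]
    obtain ⟨a, b, hab⟩ := hfix _ hjfix
    refine ⟨a, b, ?_⟩
    rw [← hab, div_mul_eq_mul_div, eq_div_iff hD, hj]
  -- `σ x₁ = m(x₁)`
  left
  rcases hE49 K hd r hr σ hσr hσ x₂ y₂ hy₂ with hx₂ | hx₂
  · -- `σ x₂ = x₂`: census `m×id` ⇒ `x₁ = −1/3`, `j = 0`
    rw [hx₂] at hΨσ
    have h13 := hZmi K hd ⟨r, hr⟩ x₁ y₁ x₂ (σ x₁) hy₁ hΨ hx₁ hΨσ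
    refine hasCM_of_c₄_cube_eq_mul_Δ' E hΔ (q := 0) (by decide) ?_
    have hN := fls_N_eq_zero_of_three_mul_add_one h13
    have h0 : (E.baseChange K).c₄ ^ 3 * ((x₁ ^ 3 + x₁ ^ 2 - 2 * x₁ - 1) ^ 7) = 0 := by rw [hj, hN, zero_mul]
    rcases mul_eq_zero.1 h0 with h | h
    · rw [h]; push_cast; ring
    · exact absurd h hD
  · -- `σ x₂ = m(x₂)`: census `m×m` ⇒ `x₁ = −1/3` or `x₁² + 10x₁ + 4 = 0`, `j = 0` either way
    have hmm := hZmm K hd ⟨r, hr⟩ x₁ y₁ x₂ (σ x₁) (σ x₂) hy₁ hΨ hx₁ hx₂ hΨσ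
    refine hasCM_of_c₄_cube_eq_mul_Δ' E hΔ (q := 0) (by decide) ?_
    have hN : ((3 * x₁ + 1) ^ 3 * (4 * x₁ ^ 2 + 5 * x₁ + 2) ^ 3 * (x₁ ^ 2 + 3 * x₁ + 4) ^ 3 * (x₁ ^ 2 + 10 * x₁ + 4) ^ 3) = 0 := by
      rcases hmm with h | h
      · exact fls_N_eq_zero_of_three_mul_add_one h
      · exact fls_N_eq_zero_of_sq_add h
    have h0 : (E.baseChange K).c₄ ^ 3 * ((x₁ ^ 3 + x₁ ^ 2 - 2 * x₁ - 1) ^ 7) = 0 := by rw [hj, hN, zero_mul]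
    rcases mul_eq_zero.1 h0 with h | h
    · rw [h]; push_cast; ring
    · exact absurd h hD

/-- **`CertB3E7` BY NAME** — the route item stmt-Langlands-23416 (rev 7, child of
`RefinedLocusModular` for the carrier `X(b3,e7)`, sheet 4.5), i.e. the decl
`Summit.Langlands.Langlands.Theses.SqrtFiveQuarticCovers.CertB3E7`, from the named inputs NF-K1-E10
(`hK1`), NF-E10-MW (`hE49`) and the certified census NF-E10-ZDS (`hZmm`, `hZmi`):
`certB3E7_of_modelIdentification_of_census` read through the definitional unfolding of the item.
CONDITIONAL on the four hypotheses (the item stays open modulo these named inputs; «a certified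
finite datum is not a modularity statement»). [cite: FreitasLeHungSiksek2015, Lemma 4.2 (p. 28)]
[cite: Box2022, §1.1 and Thm. 7.1] -/
theorem certB3E7
    (hK1 : ∀ (K : Type) [Field K] [NumberField K], Module.finrank ℚ K = 4 → (∃ r : K, r ^ 2 = 5) →
        ∀ E : WeierstrassCurve (NumberField.RingOfIntegers K), E.Δ ≠ 0 →
          (∃ ρ : Literature.NumberTheory.GaloisRepresentations.FramedGaloisRep K (ZMod 3) 2, (∃ e : (E.baseChange K).geomTorsion ((3 : ℕ) : ℤ) ≃+ (Fin 2 → ZMod 3), ∀ (σ : Field.absoluteGaloisGroup K) (P : (E.baseChange K).geomTorsion ((3 : ℕ) : ℤ)), e (σ • P) = ((ρ σ : GL (Fin 2) (ZMod 3)) : Matrix (Fin 2) (Fin 2) (ZMod 3)) *ᵥ (e P)) ∧ ((∀ σ : Field.absoluteGaloisGroup K, (((ρ σ : GL (Fin 2) (ZMod 3)) : Matrix (Fin 2) (Fin 2) (ZMod 3)) 1 0 = 0)))) →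
          (∃ ρ : Literature.NumberTheory.GaloisRepresentations.FramedGaloisRep K (ZMod 7) 2, (∃ e : (E.baseChange K).geomTorsion ((7 : ℕ) : ℤ) ≃+ (Fin 2 → ZMod 7), ∀ (σ : Field.absoluteGaloisGroup K) (P : (E.baseChange K).geomTorsion ((7 : ℕ) : ℤ)), e (σ • P) = ((ρ σ : GL (Fin 2) (ZMod 7)) : Matrix (Fin 2) (Fin 2) (ZMod 7)) *ᵥ (e P)) ∧ ((∀ σ : Field.absoluteGaloisGroup K, (ρ σ : GL (Fin 2) (ZMod 7)) ∈ Subgroup.closure ({(⟨!![0, 5; 3, 0], !![0, 5; 3, 0], by decide, by decide⟩ : GL (Fin 2) (ZMod 7)), (⟨!![5, 0; 3, 2], !![3, 0; 6, 4], by decide, by decide⟩ : GL (Fin 2) (ZMod 7))} : Set (GL (Fin 2) (ZMod 7)))))) →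
          ((E.baseChange K).c₄ ^ 3 = 1728 * (E.baseChange K).Δ ∨
           ∃ x₁ y₁ x₂ y₂ : K, y₁ ^ 2 = 7 * (16 * x₁ ^ 4 + 68 * x₁ ^ 3 + 111 * x₁ ^ 2 + 62 * x₁ + 11) ∧ y₂ ^ 2 = 7 * (16 * x₂ ^ 4 + 68 * x₂ ^ 3 + 111 * x₂ ^ 2 + 62 * x₂ + 11) ∧
            ((x₁ ^ 3 + x₁ ^ 2 - 2 * x₁ - 1) ^ 7) ≠ 0 ∧
            (E.baseChange K).c₄ ^ 3 * ((x₁ ^ 3 + x₁ ^ 2 - 2 * x₁ - 1) ^ 7) = ((3 * x₁ + 1) ^ 3 * (4 * x₁ ^ 2 + 5 * x₁ + 2) ^ 3 * (x₁ ^ 2 + 3 * x₁ + 4) ^ 3 * (x₁ ^ 2 + 10 * x₁ + 4) ^ 3) * (E.baseChange K).Δ ∧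
            ((3 * x₂ ^ 2 + 6 * x₂ + 2) ^ 2 * x₁ ^ 4 + (36 * x₂ ^ 4 + 125 * x₂ ^ 3 + 138 * x₂ ^ 2 + 60 * x₂ + 9) * x₁ ^ 3 + (48 * x₂ ^ 4 + 138 * x₂ ^ 3 + 111 * x₂ ^ 2 + 33 * x₂ + 3) * x₁ ^ 2 + (24 * x₂ ^ 4 + 60 * x₂ ^ 3 + 33 * x₂ ^ 2 + 5 * x₂) * x₁ + (4 * x₂ ^ 4 + 9 * x₂ ^ 3 + 3 * x₂ ^ 2)) = 0))
        (hE49 : ∀ (K : Type) [Field K] [NumberField K], Module.finrank ℚ K = 4 → ∀ r : K, r ^ 2 = 5 →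
        ∀ σ : K →+* K, σ r = r → σ ≠ RingHom.id K →
          ∀ x y : K, y ^ 2 = 7 * (16 * x ^ 4 + 68 * x ^ 3 + 111 * x ^ 2 + 62 * x + 11) → (σ x = x ∨ (12 * x + 5) * σ x = -(5 * x + 2)))
        (hZmm : ∀ (K : Type) [Field K] [NumberField K], Module.finrank ℚ K = 4 → (∃ r : K, r ^ 2 = 5) →
        ∀ x₁ y₁ x₂ x₁' x₂' : K, y₁ ^ 2 = 7 * (16 * x₁ ^ 4 + 68 * x₁ ^ 3 + 111 * x₁ ^ 2 + 62 * x₁ + 11) →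
          ((3 * x₂ ^ 2 + 6 * x₂ + 2) ^ 2 * x₁ ^ 4 + (36 * x₂ ^ 4 + 125 * x₂ ^ 3 + 138 * x₂ ^ 2 + 60 * x₂ + 9) * x₁ ^ 3 + (48 * x₂ ^ 4 + 138 * x₂ ^ 3 + 111 * x₂ ^ 2 + 33 * x₂ + 3) * x₁ ^ 2 + (24 * x₂ ^ 4 + 60 * x₂ ^ 3 + 33 * x₂ ^ 2 + 5 * x₂) * x₁ + (4 * x₂ ^ 4 + 9 * x₂ ^ 3 + 3 * x₂ ^ 2)) = 0 →
          (12 * x₁ + 5) * x₁' = -(5 * x₁ + 2) → (12 * x₂ + 5) * x₂' = -(5 * x₂ + 2) →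
          ((3 * x₂' ^ 2 + 6 * x₂' + 2) ^ 2 * x₁' ^ 4 + (36 * x₂' ^ 4 + 125 * x₂' ^ 3 + 138 * x₂' ^ 2 + 60 * x₂' + 9) * x₁' ^ 3 + (48 * x₂' ^ 4 + 138 * x₂' ^ 3 + 111 * x₂' ^ 2 + 33 * x₂' + 3) * x₁' ^ 2 + (24 * x₂' ^ 4 + 60 * x₂' ^ 3 + 33 * x₂' ^ 2 + 5 * x₂') * x₁' + (4 * x₂' ^ 4 + 9 * x₂' ^ 3 + 3 * x₂' ^ 2)) = 0 →
          (3 * x₁ + 1 = 0 ∨ x₁ ^ 2 + 10 * x₁ + 4 = 0))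
        (hZmi : ∀ (K : Type) [Field K] [NumberField K], Module.finrank ℚ K = 4 → (∃ r : K, r ^ 2 = 5) →
        ∀ x₁ y₁ x₂ x₁' : K, y₁ ^ 2 = 7 * (16 * x₁ ^ 4 + 68 * x₁ ^ 3 + 111 * x₁ ^ 2 + 62 * x₁ + 11) →
          ((3 * x₂ ^ 2 + 6 * x₂ + 2) ^ 2 * x₁ ^ 4 + (36 * x₂ ^ 4 + 125 * x₂ ^ 3 + 138 * x₂ ^ 2 + 60 * x₂ + 9) * x₁ ^ 3 + (48 * x₂ ^ 4 + 138 * x₂ ^ 3 + 111 * x₂ ^ 2 + 33 * x₂ + 3) * x₁ ^ 2 + (24 * x₂ ^ 4 + 60 * x₂ ^ 3 + 33 * x₂ ^ 2 + 5 * x₂) * x₁ + (4 * x₂ ^ 4 + 9 * x₂ ^ 3 + 3 * x₂ ^ 2)) = 0 →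
          (12 * x₁ + 5) * x₁' = -(5 * x₁ + 2) →
          ((3 * x₂ ^ 2 + 6 * x₂ + 2) ^ 2 * x₁' ^ 4 + (36 * x₂ ^ 4 + 125 * x₂ ^ 3 + 138 * x₂ ^ 2 + 60 * x₂ + 9) * x₁' ^ 3 + (48 * x₂ ^ 4 + 138 * x₂ ^ 3 + 111 * x₂ ^ 2 + 33 * x₂ + 3) * x₁' ^ 2 + (24 * x₂ ^ 4 + 60 * x₂ ^ 3 + 33 * x₂ ^ 2 + 5 * x₂) * x₁' + (4 * x₂ ^ 4 + 9 * x₂ ^ 3 + 3 * x₂ ^ 2)) = 0 →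
          3 * x₁ + 1 = 0) :
    Summit.Langlands.Langlands.Theses.SqrtFiveQuarticCovers.CertB3E7 :=
  certB3E7_of_modelIdentification_of_census hK1 hE49 hZmm hZmi

set_option maxHeartbeats 1000000 in -- eleven written-out hypothesis types with `decide`d matrix entries; statement elaboration only
/-- **The crux `RefinedLocusModular` with the certificate `CertE` (`CertB3H12E7`) DISCHARGED modulo
its named inputs** (`hK1` NF-K1-E10, `hE49` NF-E10-MW, `hZmm`/`hZmi` NF-E10-ZDS; lineages
27124f46183f2158 + 74120e68cc47c051; certnum l.140–l.142): the tree's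
`refinedLocusModular_of_certificates` with `hE := certB3E7_of_modelIdentification_of_census`.
The remaining hypotheses are the other four certificates (`hA`, `hB7`, `hC`, `hD`, verbatim) and
the two bridge facts.  CONDITIONAL bookkeeping; nothing here proves modularity of a new class.
[cite: Box2022, §1.1 and Thm. 7.1] [cite: FreitasLeHungSiksek2015, Thm. 1 and §7] -/
theorem refinedLocusModular_of_certificates_of_census
(hK1 : ∀ (K : Type) [Field K] [NumberField K], Module.finrank ℚ K = 4 → (∃ r : K, r ^ 2 = 5) →
        ∀ E : WeierstrassCurve (NumberField.RingOfIntegers K), E.Δ ≠ 0 →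
          (∃ ρ : Literature.NumberTheory.GaloisRepresentations.FramedGaloisRep K (ZMod 3) 2, (∃ e : (E.baseChange K).geomTorsion ((3 : ℕ) : ℤ) ≃+ (Fin 2 → ZMod 3), ∀ (σ : Field.absoluteGaloisGroup K) (P : (E.baseChange K).geomTorsion ((3 : ℕ) : ℤ)), e (σ • P) = ((ρ σ : GL (Fin 2) (ZMod 3)) : Matrix (Fin 2) (Fin 2) (ZMod 3)) *ᵥ (e P)) ∧ ((∀ σ : Field.absoluteGaloisGroup K, (((ρ σ : GL (Fin 2) (ZMod 3)) : Matrix (Fin 2) (Fin 2) (ZMod 3)) 1 0 = 0)))) →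
          (∃ ρ : Literature.NumberTheory.GaloisRepresentations.FramedGaloisRep K (ZMod 7) 2, (∃ e : (E.baseChange K).geomTorsion ((7 : ℕ) : ℤ) ≃+ (Fin 2 → ZMod 7), ∀ (σ : Field.absoluteGaloisGroup K) (P : (E.baseChange K).geomTorsion ((7 : ℕ) : ℤ)), e (σ • P) = ((ρ σ : GL (Fin 2) (ZMod 7)) : Matrix (Fin 2) (Fin 2) (ZMod 7)) *ᵥ (e P)) ∧ ((∀ σ : Field.absoluteGaloisGroup K, (ρ σ : GL (Fin 2) (ZMod 7)) ∈ Subgroup.closure ({(⟨!![0, 5; 3, 0], !![0, 5; 3, 0], by decide, by decide⟩ : GL (Fin 2) (ZMod 7)), (⟨!![5, 0; 3, 2], !![3, 0; 6, 4], by decide, by decide⟩ : GL (Fin 2) (ZMod 7))} : Set (GL (Fin 2) (ZMod 7)))))) →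
          ((E.baseChange K).c₄ ^ 3 = 1728 * (E.baseChange K).Δ ∨
           ∃ x₁ y₁ x₂ y₂ : K, y₁ ^ 2 = 7 * (16 * x₁ ^ 4 + 68 * x₁ ^ 3 + 111 * x₁ ^ 2 + 62 * x₁ + 11) ∧ y₂ ^ 2 = 7 * (16 * x₂ ^ 4 + 68 * x₂ ^ 3 + 111 * x₂ ^ 2 + 62 * x₂ + 11) ∧
            ((x₁ ^ 3 + x₁ ^ 2 - 2 * x₁ - 1) ^ 7) ≠ 0 ∧
            (E.baseChange K).c₄ ^ 3 * ((x₁ ^ 3 + x₁ ^ 2 - 2 * x₁ - 1) ^ 7) = ((3 * x₁ + 1) ^ 3 * (4 * x₁ ^ 2 + 5 * x₁ + 2) ^ 3 * (x₁ ^ 2 + 3 * x₁ + 4) ^ 3 * (x₁ ^ 2 + 10 * x₁ + 4) ^ 3) * (E.baseChange K).Δ ∧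
            ((3 * x₂ ^ 2 + 6 * x₂ + 2) ^ 2 * x₁ ^ 4 + (36 * x₂ ^ 4 + 125 * x₂ ^ 3 + 138 * x₂ ^ 2 + 60 * x₂ + 9) * x₁ ^ 3 + (48 * x₂ ^ 4 + 138 * x₂ ^ 3 + 111 * x₂ ^ 2 + 33 * x₂ + 3) * x₁ ^ 2 + (24 * x₂ ^ 4 + 60 * x₂ ^ 3 + 33 * x₂ ^ 2 + 5 * x₂) * x₁ + (4 * x₂ ^ 4 + 9 * x₂ ^ 3 + 3 * x₂ ^ 2)) = 0))
    (hE49 : ∀ (K : Type) [Field K] [NumberField K], Module.finrank ℚ K = 4 → ∀ r : K, r ^ 2 = 5 →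
        ∀ σ : K →+* K, σ r = r → σ ≠ RingHom.id K →
          ∀ x y : K, y ^ 2 = 7 * (16 * x ^ 4 + 68 * x ^ 3 + 111 * x ^ 2 + 62 * x + 11) → (σ x = x ∨ (12 * x + 5) * σ x = -(5 * x + 2)))
    (hZmm : ∀ (K : Type) [Field K] [NumberField K], Module.finrank ℚ K = 4 → (∃ r : K, r ^ 2 = 5) →
        ∀ x₁ y₁ x₂ x₁' x₂' : K, y₁ ^ 2 = 7 * (16 * x₁ ^ 4 + 68 * x₁ ^ 3 + 111 * x₁ ^ 2 + 62 * x₁ + 11) →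
          ((3 * x₂ ^ 2 + 6 * x₂ + 2) ^ 2 * x₁ ^ 4 + (36 * x₂ ^ 4 + 125 * x₂ ^ 3 + 138 * x₂ ^ 2 + 60 * x₂ + 9) * x₁ ^ 3 + (48 * x₂ ^ 4 + 138 * x₂ ^ 3 + 111 * x₂ ^ 2 + 33 * x₂ + 3) * x₁ ^ 2 + (24 * x₂ ^ 4 + 60 * x₂ ^ 3 + 33 * x₂ ^ 2 + 5 * x₂) * x₁ + (4 * x₂ ^ 4 + 9 * x₂ ^ 3 + 3 * x₂ ^ 2)) = 0 →
          (12 * x₁ + 5) * x₁' = -(5 * x₁ + 2) → (12 * x₂ + 5) * x₂' = -(5 * x₂ + 2) →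
          ((3 * x₂' ^ 2 + 6 * x₂' + 2) ^ 2 * x₁' ^ 4 + (36 * x₂' ^ 4 + 125 * x₂' ^ 3 + 138 * x₂' ^ 2 + 60 * x₂' + 9) * x₁' ^ 3 + (48 * x₂' ^ 4 + 138 * x₂' ^ 3 + 111 * x₂' ^ 2 + 33 * x₂' + 3) * x₁' ^ 2 + (24 * x₂' ^ 4 + 60 * x₂' ^ 3 + 33 * x₂' ^ 2 + 5 * x₂') * x₁' + (4 * x₂' ^ 4 + 9 * x₂' ^ 3 + 3 * x₂' ^ 2)) = 0 →
          (3 * x₁ + 1 = 0 ∨ x₁ ^ 2 + 10 * x₁ + 4 = 0))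
    (hZmi : ∀ (K : Type) [Field K] [NumberField K], Module.finrank ℚ K = 4 → (∃ r : K, r ^ 2 = 5) →
        ∀ x₁ y₁ x₂ x₁' : K, y₁ ^ 2 = 7 * (16 * x₁ ^ 4 + 68 * x₁ ^ 3 + 111 * x₁ ^ 2 + 62 * x₁ + 11) →
          ((3 * x₂ ^ 2 + 6 * x₂ + 2) ^ 2 * x₁ ^ 4 + (36 * x₂ ^ 4 + 125 * x₂ ^ 3 + 138 * x₂ ^ 2 + 60 * x₂ + 9) * x₁ ^ 3 + (48 * x₂ ^ 4 + 138 * x₂ ^ 3 + 111 * x₂ ^ 2 + 33 * x₂ + 3) * x₁ ^ 2 + (24 * x₂ ^ 4 + 60 * x₂ ^ 3 + 33 * x₂ ^ 2 + 5 * x₂) * x₁ + (4 * x₂ ^ 4 + 9 * x₂ ^ 3 + 3 * x₂ ^ 2)) = 0 →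
          (12 * x₁ + 5) * x₁' = -(5 * x₁ + 2) →
          ((3 * x₂ ^ 2 + 6 * x₂ + 2) ^ 2 * x₁' ^ 4 + (36 * x₂ ^ 4 + 125 * x₂ ^ 3 + 138 * x₂ ^ 2 + 60 * x₂ + 9) * x₁' ^ 3 + (48 * x₂ ^ 4 + 138 * x₂ ^ 3 + 111 * x₂ ^ 2 + 33 * x₂ + 3) * x₁' ^ 2 + (24 * x₂ ^ 4 + 60 * x₂ ^ 3 + 33 * x₂ ^ 2 + 5 * x₂) * x₁' + (4 * x₂ ^ 4 + 9 * x₂ ^ 3 + 3 * x₂ ^ 2)) = 0 →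
          3 * x₁ + 1 = 0)
    (hA : ∀ (K : Type) [Field K] [NumberField K], NumberField.IsTotallyReal K → Module.finrank ℚ K = 4 → (∃ r : K, r ^ 2 = 5) →
        ∀ E : WeierstrassCurve (NumberField.RingOfIntegers K), E.Δ ≠ 0 →
          (∃ ρ : Literature.NumberTheory.GaloisRepresentations.FramedGaloisRep K (ZMod 3) 2, (∃ e : (E.baseChange K).geomTorsion ((3 : ℕ) : ℤ) ≃+ (Fin 2 → ZMod 3), ∀ (σ : Field.absoluteGaloisGroup K) (P : (E.baseChange K).geomTorsion ((3 : ℕ) : ℤ)), e (σ • P) = ((ρ σ : GL (Fin 2) (ZMod 3)) : Matrix (Fin 2) (Fin 2) (ZMod 3)) *ᵥ (e P)) ∧ ((∀ σ : Field.absoluteGaloisGroup K, (((ρ σ : GL (Fin 2) (ZMod 3)) : Matrix (Fin 2) (Fin 2) (ZMod 3)) 1 0 = 0)))) →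
          (∃ ρ : Literature.NumberTheory.GaloisRepresentations.FramedGaloisRep K (ZMod 5) 2, (∃ e : (E.baseChange K).geomTorsion ((5 : ℕ) : ℤ) ≃+ (Fin 2 → ZMod 5), ∀ (σ : Field.absoluteGaloisGroup K) (P : (E.baseChange K).geomTorsion ((5 : ℕ) : ℤ)), e (σ • P) = ((ρ σ : GL (Fin 2) (ZMod 5)) : Matrix (Fin 2) (Fin 2) (ZMod 5)) *ᵥ (e P)) ∧ ((∀ σ : Field.absoluteGaloisGroup K, (ρ σ : GL (Fin 2) (ZMod 5)) ∈ Subgroup.closure ({(⟨!![2, 0; 0, 3], !![3, 0; 0, 2], by decide, by decide⟩ : GL (Fin 2) (ZMod 5)), (⟨!![0, 1; 1, 0], !![0, 1; 1, 0], by decide, by decide⟩ : GL (Fin 2) (ZMod 5))} : Set (GL (Fin 2) (ZMod 5)))))) →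
          ((∃ ρ : Literature.NumberTheory.GaloisRepresentations.FramedGaloisRep K (ZMod 7) 2, (∃ e : (E.baseChange K).geomTorsion ((7 : ℕ) : ℤ) ≃+ (Fin 2 → ZMod 7), ∀ (σ : Field.absoluteGaloisGroup K) (P : (E.baseChange K).geomTorsion ((7 : ℕ) : ℤ)), e (σ • P) = ((ρ σ : GL (Fin 2) (ZMod 7)) : Matrix (Fin 2) (Fin 2) (ZMod 7)) *ᵥ (e P)) ∧ ((∀ σ : Field.absoluteGaloisGroup K, (((ρ σ : GL (Fin 2) (ZMod 7)) : Matrix (Fin 2) (Fin 2) (ZMod 7)) 1 0 = 0)))) ∨ (∃ ρ : Literature.NumberTheory.GaloisRepresentations.FramedGaloisRep K (ZMod 7) 2, (∃ e : (E.baseChange K).geomTorsion ((7 : ℕ) : ℤ) ≃+ (Fin 2 → ZMod 7), ∀ (σ : Field.absoluteGaloisGroup K) (P : (E.baseChange K).geomTorsion ((7 : ℕ) : ℤ)), e (σ • P) = ((ρ σ : GL (Fin 2) (ZMod 7)) : Matrix (Fin 2) (Fin 2) (ZMod 7)) *ᵥ (e P)) ∧ ((∀ σ : Field.absoluteGaloisGroup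 K, (ρ σ : GL (Fin 2) (ZMod 7)) ∈ Subgroup.closure ({(⟨!![0, 5; 3, 0], !![0, 5; 3, 0], by decide, by decide⟩ : GL (Fin 2) (ZMod 7)), (⟨!![5, 0; 3, 2], !![3, 0; 6, 4], by decide, by decide⟩ : GL (Fin 2) (ZMod 7))} : Set (GL (Fin 2) (ZMod 7))))))) →
          ((E.baseChange K).HasCM ∨ (∃ r : K, r ^ 2 = 5 ∧ ∃ a b : ℚ, (E.baseChange K).c₄ ^ 3 = ((a : K) + (b : K) * r) * (E.baseChange K).Δ)))
    (hB7 : ∀ (K : Type) [Field K] [NumberField K], NumberField.IsTotallyReal K → Module.finrank ℚ K = 4 → (∃ r : K, r ^ 2 = 5) →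
        ∀ E : WeierstrassCurve (NumberField.RingOfIntegers K), E.Δ ≠ 0 →
          (∃ ρ : Literature.NumberTheory.GaloisRepresentations.FramedGaloisRep K (ZMod 5) 2, (∃ e : (E.baseChange K).geomTorsion ((5 : ℕ) : ℤ) ≃+ (Fin 2 → ZMod 5), ∀ (σ : Field.absoluteGaloisGroup K) (P : (E.baseChange K).geomTorsion ((5 : ℕ) : ℤ)), e (σ • P) = ((ρ σ : GL (Fin 2) (ZMod 5)) : Matrix (Fin 2) (Fin 2) (ZMod 5)) *ᵥ (e P)) ∧ ((∀ σ : Field.absoluteGaloisGroup K, (ρ σ : GL (Fin 2) (ZMod 5)) ∈ Subgroup.closure ({(⟨!![3, 1; 3, 3], !![3, 4; 2, 3], by decide, by decide⟩ : GL (Fin 2) (ZMod 5)), (⟨!![1, 0; 0, 4], !![1, 0; 0, 4], by decide, by decide⟩ : GL (Fin 2) (ZMod 5))} : Set (GL (Fin 2) (ZMod 5)))))) →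
          (∃ ρ : Literature.NumberTheory.GaloisRepresentations.FramedGaloisRep K (ZMod 7) 2, (∃ e : (E.baseChange K).geomTorsion ((7 : ℕ) : ℤ) ≃+ (Fin 2 → ZMod 7), ∀ (σ : Field.absoluteGaloisGroup K) (P : (E.baseChange K).geomTorsion ((7 : ℕ) : ℤ)), e (σ • P) = ((ρ σ : GL (Fin 2) (ZMod 7)) : Matrix (Fin 2) (Fin 2) (ZMod 7)) *ᵥ (e P)) ∧ ((∀ σ : Field.absoluteGaloisGroup K, (((ρ σ : GL (Fin 2) (ZMod 7)) : Matrix (Fin 2) (Fin 2) (ZMod 7)) 1 0 = 0)))) →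
          ((E.baseChange K).HasCM ∨ (∃ r : K, r ^ 2 = 5 ∧ ∃ a b : ℚ, (E.baseChange K).c₄ ^ 3 = ((a : K) + (b : K) * r) * (E.baseChange K).Δ)))
    (hC : ∀ (K : Type) [Field K] [NumberField K], NumberField.IsTotallyReal K → Module.finrank ℚ K = 4 → (∃ r : K, r ^ 2 = 5) →
        ∀ E : WeierstrassCurve (NumberField.RingOfIntegers K), E.Δ ≠ 0 →
          (∃ ρ : Literature.NumberTheory.GaloisRepresentations.FramedGaloisRep K (ZMod 3) 2, (∃ e : (E.baseChange K).geomTorsion ((3 : ℕ) : ℤ) ≃+ (Fin 2 → ZMod 3), ∀ (σ : Field.absoluteGaloisGroup K) (P : (E.baseChange K).geomTorsion ((3 : ℕ) : ℤ)), e (σ • P) = ((ρ σ : GL (Fin 2) (ZMod 3)) : Matrix (Fin 2) (Fin 2) (ZMod 3)) *ᵥ (e P)) ∧ ((∀ σ : Field.absoluteGaloisGroup K, (ρ σ : GL (Fin 2) (ZMod 3)) ∈ Subgroup.closure ({(⟨!![1, 0; 0, 2], !![1, 0; 0, 2], by decide, by decide⟩ : GL (Fin 2) (ZMod 3)), (⟨!![0,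 1; 1, 0], !![0, 1; 1, 0], by decide, by decide⟩ : GL (Fin 2) (ZMod 3))} : Set (GL (Fin 2) (ZMod 3)))))) →
          (∃ ρ : Literature.NumberTheory.GaloisRepresentations.FramedGaloisRep K (ZMod 5) 2, (∃ e : (E.baseChange K).geomTorsion ((5 : ℕ) : ℤ) ≃+ (Fin 2 → ZMod 5), ∀ (σ : Field.absoluteGaloisGroup K) (P : (E.baseChange K).geomTorsion ((5 : ℕ) : ℤ)), e (σ • P) = ((ρ σ : GL (Fin 2) (ZMod 5)) : Matrix (Fin 2) (Fin 2) (ZMod 5)) *ᵥ (e P)) ∧ ((∀ σ : Field.absoluteGaloisGroup K, (ρ σ : GL (Fin 2) (ZMod 5)) ∈ Subgroup.closure ({(⟨!![2, 0; 0, 3], !![3, 0; 0, 2], by decide, by decide⟩ : GL (Fin 2) (ZMod 5)), (⟨!![0, 1; 1, 0], !![0, 1; 1, 0], by decide, by decide⟩ : GL (Fin 2) (ZMod 5))} : Set (GL (Fin 2) (ZMod 5)))))) →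
          ((E.baseChange K).HasCM ∨ (∃ r : K, r ^ 2 = 5 ∧ ∃ a b : ℚ, (E.baseChange K).c₄ ^ 3 = ((a : K) + (b : K) * r) * (E.baseChange K).Δ)))
    (hD : ∀ (K : Type) [Field K] [NumberField K], NumberField.IsTotallyReal K → Module.finrank ℚ K = 4 → (∃ r : K, r ^ 2 = 5) →
        ∀ E : WeierstrassCurve (NumberField.RingOfIntegers K), E.Δ ≠ 0 →
          (∃ ρ : Literature.NumberTheory.GaloisRepresentations.FramedGaloisRep K (ZMod 3) 2, (∃ e : (E.baseChange K).geomTorsion ((3 : ℕ) : ℤ) ≃+ (Fin 2 → ZMod 3), ∀ (σ : Field.absoluteGaloisGroup K) (P : (E.baseChange K).geomTorsion ((3 : ℕ) : ℤ)), e (σ • P) = ((ρ σ : GL (Fin 2) (ZMod 3)) : Matrix (Fin 2) (Fin 2) (ZMod 3)) *ᵥ (e P)) ∧ ((∀ σ : Field.absoluteGaloisGroup K, (ρ σ : GL (Fin 2) (ZMod 3)) ∈ Subgroup.closure ({(⟨!![1, 0; 0, 2], !![1, 0; 0, 2], by decide, by decide⟩ : GL (Fin 2) (ZMod 3)), (⟨!![0,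 1; 1, 0], !![0, 1; 1, 0], by decide, by decide⟩ : GL (Fin 2) (ZMod 3))} : Set (GL (Fin 2) (ZMod 3)))))) →
          (∃ ρ : Literature.NumberTheory.GaloisRepresentations.FramedGaloisRep K (ZMod 5) 2, (∃ e : (E.baseChange K).geomTorsion ((5 : ℕ) : ℤ) ≃+ (Fin 2 → ZMod 5), ∀ (σ : Field.absoluteGaloisGroup K) (P : (E.baseChange K).geomTorsion ((5 : ℕ) : ℤ)), e (σ • P) = ((ρ σ : GL (Fin 2) (ZMod 5)) : Matrix (Fin 2) (Fin 2) (ZMod 5)) *ᵥ (e P)) ∧ ((∀ σ : Field.absoluteGaloisGroup K, (ρ σ : GL (Fin 2) (ZMod 5)) ∈ Subgroup.closure ({(⟨!![3, 1; 3, 3], !![3, 4; 2, 3], by decide, by decide⟩ : GL (Fin 2) (ZMod 5)), (⟨!![1, 0; 0, 4], !![1, 0; 0, 4], by decide, by decide⟩ : GL (Fin 2) (ZMod 5))} : Set (GL (Fin 2) (ZMod 5)))))) →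
          ((E.baseChange K).HasCM ∨ (∃ r : K, r ^ 2 = 5 ∧ ∃ a b : ℚ, (E.baseChange K).c₄ ^ 3 = ((a : K) + (b : K) * r) * (E.baseChange K).Δ)))
    (hFLS : FLS2015_theorem1)
    (hBC : isModularEllipticCurve_baseChange_of_isSolvable_of_isAutomorphicOfWeightZero) :
    Summit.Langlands.Langlands.Theses.SqrtFiveQuarticCovers.RefinedLocusModular :=
  refinedLocusModular_of_certificates hA hB7 hC hD
    (certB3E7_of_modelIdentification_of_census hK1 hE49 hZmm hZmi) hFLS hBC

end Summit.Langlands.Langlands.Theorems.SqrtFiveQuarticCovers
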